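import Summits.CriticalPhenomena.PercolationContinuityZ3.Theorems.PercNearOneGluingNoHeavyLowerTailSunflowerChainCertificateStructure
import HarnessLib
import HarnessLib.Audit

/-!
# `NoHeavyLowerTail` (crux stmt-CriticalPhenomena-4575), abstract sunflower cubic: ORDER DUALITY for chain certificates — the pole-`B`
# half of `ChainCert.ThreeBlockMedianCertificate` is the pole-`T` half for the dual labelling

Support file (seat `prim-ineq-prove-1` gen 33; `--supports stmt-CriticalPhenomena-4575`; companion of `…SunflowerChainCertificate` (p243463)
and `…SunflowerChainCertificateStructure`).  No `sorry`, no named facts, nothing asserted about the crux.  Memo: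
run/shared/lean/prim/prim-ineq-prove-1/FINDING-CHAINCERT-prove1-g33.md §3.

DUALITY.  Reversing every chain (`revPt`, `revTr`) and exchanging the pole labels `0 ↔ 1` (`swap01`) sends a monotone labelling `lab`
to a monotone labelling `dual lab` (`dual_mono`); medians commute with reversal and join/meet are exchanged (`med_revTr`, `join_revTr`,
`meet_revTr`), rainbows are preserved (`isRainbow_dual_iff`), so the pole-`B` median set of `lab` is the reversed pole-`T` median set of
the dual with the pair transposed: `LamB lab s t ↔ LamT (dual lab) (rev t) (rev s)` (`lamB_iff_lamT_dual`, `mB_eq_mT_dual`).  On the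
symmetric kernels (`ChainCert.kerSym`, file …Structure) this gives `kerSym_B_eq`: the pole-`B` kernel of `lab` at `(x,y,z)` is the
pole-`T` kernel of `dual lab` at the reversed triple, up to transposing the two transfer slots — and orbit sums do not see slot
permutations (`orbitSum_slotPerm`) nor reversal (`orbitSum_revTr`).  Hence
* `localCond_B_of_dual` : `LocalCond 1 0 (dual lab) (mT (dual lab)) → LocalCond 0 1 lab (mB lab)`;
* `threeBlockMedianCertificate_of_poleT` : the certificate `ThreeBlockMedianCertificate` (both poles, all monotone labellings of all
  products of three chains) follows from its pole-`T` half alone — the kernel replay needs ONE finite enumeration, not two (g32 memo §1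
  reached the same halving by a different route, `λ_T ≤ g`).
-/

namespace Summit.CriticalPhenomena.PercolationContinuityZ3.Theorems.SunflowerPartition

namespace ChainCert

open Finset

/-! ## Reversal and the dual labelling (any number of blocks) -/


section Duality

variable {k : ℕ} {n : Fin k → ℕ}

/-- Order reversal of a point (reverse every chain). [this work] -/
def revPt (x : Pt n) : Pt n := fun e => Fin.rev (x e)

/-- `revPt` is an involution. [this work] -/
@[simp] theorem revPt_revPt (x : Pt n) : revPt (revPt x) = x := by
  funext e; simp [revPt]

/-- `revPt` is antitone. [this work] -/
theorem revPt_le_revPt {x y : Pt n} (h : x ≤ y) : revPt y ≤ revPt x :=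
  fun e => Fin.rev_le_rev.mpr (h e)

/-- Swap of the two pole labels `0 ↔ 1` (petal labels unchanged). [this work] -/
def swap01 (v : ℕ) : ℕ := if v = 0 then 1 else if v = 1 then 0 else v

/-- The DUAL labelling: reverse the order and exchange kernel and bottom. [this work] -/
def dual (lab : Pt n → ℕ) : Pt n → ℕ := fun x => swap01 (lab (revPt x))

/-- Values of the dual labelling. [this work] -/
theorem dual_eq_zero_iff (lab : Pt n → ℕ) (x : Pt n) : dual lab x = 0 ↔ lab (revPt x) = 1 := by
  simp only [dual, swap01]
  by_cases h0 : lab (revPt x) = 0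
  · simp [h0]
  · by_cases h1 : lab (revPt x) = 1
    · simp [h1]
    · simp [h0, h1]

/-- Values of the dual labelling. [this work] -/
theorem dual_eq_one_iff (lab : Pt n → ℕ) (x : Pt n) : dual lab x = 1 ↔ lab (revPt x) = 0 := by
  simp only [dual, swap01]
  by_cases h0 : lab (revPt x) = 0
  · simp [h0]
  · by_cases h1 : lab (revPt x) = 1
    · simp [h1]
    · simp [h0, h1]

/-- Petal labels are unchanged by duality. [this work] -/
theorem dual_eq_of_two_le {lab : Pt n → ℕ} {x : Pt n} :
    (2 ≤ dual lab x ↔ 2 ≤ lab (revPt x)) ∧ (2 ≤ lab (revPt x) → dual lab x = lab (revPt x)) := by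
  unfold dual swap01; split_ifs <;> omega

/-- The dual of a monotone labelling is monotone. [this work] -/
theorem dual_mono {lab : Pt n → ℕ} (hlab : IsMono lab) : IsMono (dual lab) := by
  intro x y hxy
  have h := hlab (revPt_le_revPt hxy)
  unfold dual swap01
  rcases h with h | h | h <;> split_ifs <;> omega

/-- Order reversal of a triple of points. [this work] -/
def revTr (t : Fin 3 → Pt n) : Fin 3 → Pt n := fun i => revPt (t i)

/-- Reversal commutes with the value-permutation action. [this work] -/
theorem revTr_act (g : Sym k) (t : Fin 3 → Pt n) : revTr (act g t) = act g (revTr t) := by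
  funext i e; simp [revTr, revPt, act]

/-- Orbit sums of a reversed kernel. [this work] -/
theorem orbitSum_revTr (κ : (Fin 3 → Pt n) → ℤ) (t : Fin 3 → Pt n) :
    orbitSum (fun s => κ (revTr s)) t = orbitSum κ (revTr t) := by
  unfold orbitSum; simp_rw [revTr_act]

end Duality

section DualityThree

variable {n : Fin 3 → ℕ}

/-- Median commutes with order reversal. [this work] -/
theorem med_revTr (u : Fin 3 → Pt n) : med (revTr u) = revPt (med u) := by
  funext e
  apply Fin.ext
  simp only [med, revTr, revPt, Fin.coe_max, Fin.coe_min, Fin.val_rev]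
  omega

/-- The join of the reversed triple is the reversed meet. [this work] -/
theorem join_revTr (u : Fin 3 → Pt n) : join (revTr u) = revPt (meet u) := by
  funext e
  apply Fin.ext
  simp only [join, meet, revTr, revPt, Fin.coe_max, Fin.coe_min, Fin.val_rev]
  omega

/-- The meet of the reversed triple is the reversed join. [this work] -/
theorem meet_revTr (u : Fin 3 → Pt n) : meet (revTr u) = revPt (join u) := by
  funext e
  apply Fin.ext
  simp only [join, meet, revTr, revPt, Fin.coe_max, Fin.coe_min, Fin.val_rev]
  omega

/-- `revTr` is an involution. [this work] -/
@[simp] theorem revTr_revTr (u : Fin 3 → Pt n) : revTr (revTr u) = u := by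
  funext i; simp [revTr]

/-- Rainbows are preserved by duality. [this work] -/
theorem isRainbow_dual_iff (lab : Pt n → ℕ) (u : Fin 3 → Pt n) :
    IsRainbow (dual lab) (revTr u) ↔ IsRainbow lab u := by
  have key : ∀ i, (2 ≤ dual lab (revTr u i) ↔ 2 ≤ lab (u i)) ∧
      (2 ≤ lab (u i) → dual lab (revTr u i) = lab (u i)) := by
    intro i
    have h := @dual_eq_of_two_le _ _ lab (revTr u i)
    simp only [revTr, revPt_revPt] at h ⊢
    exact h
  constructor
  · rintro ⟨hp, h01, h02, h12⟩
    have e0 := (key 0).2 ((key 0).1.mp (hp 0)); have e1 := (key 1).2 ((key 1).1.mp (hp 1))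
    have e2 := (key 2).2 ((key 2).1.mp (hp 2))
    refine ⟨fun i => (key i).1.mp (hp i), ?_, ?_, ?_⟩
    · rw [← e0, ← e1]; exact h01
    · rw [← e0, ← e2]; exact h02
    · rw [← e1, ← e2]; exact h12
  · rintro ⟨hp, h01, h02, h12⟩
    have e0 := (key 0).2 (hp 0); have e1 := (key 1).2 (hp 1); have e2 := (key 2).2 (hp 2)
    refine ⟨fun i => (key i).1.mpr (hp i), ?_, ?_, ?_⟩
    · rw [e0, e1]; exact h01
    · rw [e0, e2]; exact h02
    · rw [e1, e2]; exact h12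

/-- **`Λ_B` is the reversed `Λ_T` of the dual labelling.** [this work] -/
theorem lamB_iff_lamT_dual (lab : Pt n → ℕ) (s t : Pt n) :
    LamB lab s t ↔ LamT (dual lab) (revPt t) (revPt s) := by
  constructor
  · rintro ⟨ht, u, hu, hmeet, hmed⟩
    refine ⟨(dual_eq_zero_iff lab _).mpr (by simpa using ht), revTr u, (isRainbow_dual_iff lab u).mpr hu, ?_, ?_⟩
    · rw [med_revTr, hmed]
    · rw [join_revTr, hmeet]
  · rintro ⟨ht, u', hu', hmed, hjoin⟩
    refine ⟨by simpa using (dual_eq_zero_iff lab _).mp ht, revTr u', ?_, ?_, ?_⟩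
    · rw [← isRainbow_dual_iff lab, revTr_revTr]; exact hu'
    · have h := meet_revTr u'
      rw [hjoin, revPt_revPt] at h; exact h
    · have h := med_revTr u'
      rw [hmed, revPt_revPt] at h; exact h

/-- The pole-`B` multiplicities are the reversed pole-`T` multiplicities of the dual (with the pair transposed). [this work] -/
theorem mB_eq_mT_dual (lab : Pt n → ℕ) (s t : Pt n) : mB lab s t = mT (dual lab) (revPt t) (revPt s) := by
  unfold mB mT
  by_cases h : LamB lab s t
  · rw [if_pos h, if_pos ((lamB_iff_lamT_dual lab s t).mp h)]
  · rw [if_neg h, if_neg (fun h' => h ((lamB_iff_lamT_dual lab s t).mpr h'))]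

/-- **Duality of the symmetric kernels**: the pole-`B` symmetric kernel of `lab` at a triple equals the pole-`T` symmetric kernel
of the dual labelling at the reversed triple, except that the transfer term has its two slots transposed. [this work] -/
theorem kerSym_B_eq (lab : Pt n → ℕ) (x y z : Pt n) :
    kerSym 0 1 lab (mB lab) x y z =
      (6 * (if dual lab (revPt x) = 1 ∧ dual lab (revPt y) = 1 ∧ dual lab (revPt z) = 0 then 1 else 0)
        - 3 * (if dual lab (revPt x) = 1 ∧ 2 ≤ dual lab (revPt y) ∧ 2 ≤ dual lab (revPt z) ∧
              dual lab (revPt y) ≠ dual lab (revPt z) then 1 else 0)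
        - (if 2 ≤ dual lab (revPt x) ∧ 2 ≤ dual lab (revPt y) ∧ 2 ≤ dual lab (revPt z) ∧
              dual lab (revPt x) ≠ dual lab (revPt y) ∧ dual lab (revPt x) ≠ dual lab (revPt z) ∧
              dual lab (revPt y) ≠ dual lab (revPt z) then 1 else 0) : ℤ)
        - 6 * ((mT (dual lab) (revPt y) (revPt x) : ℤ) *
            ((if dual lab (revPt z) = 1 then 1 else 0) - (if dual lab (revPt z) = 0 then 1 else 0))) := by
  have hx := @dual_eq_of_two_le _ _ lab (revPt x); have hy := @dual_eq_of_two_le _ _ lab (revPt y)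
  have hz := @dual_eq_of_two_le _ _ lab (revPt z)
  have hx0 := dual_eq_zero_iff lab (revPt x); have hy0 := dual_eq_zero_iff lab (revPt y)
  have hz0 := dual_eq_zero_iff lab (revPt z)
  have hx1 := dual_eq_one_iff lab (revPt x); have hy1 := dual_eq_one_iff lab (revPt y)
  have hz1 := dual_eq_one_iff lab (revPt z)
  simp only [revPt_revPt] at hx hy hz hx0 hy0 hz0 hx1 hy1 hz1
  rw [kerSym, mB_eq_mT_dual]
  have e1 : (if lab x = 0 ∧ lab y = 0 ∧ lab z = 1 then (1 : ℤ) else 0) =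
      (if dual lab (revPt x) = 1 ∧ dual lab (revPt y) = 1 ∧ dual lab (revPt z) = 0 then 1 else 0) := by
    simp only [hx1, hy1, hz0]
  have e2 : (if lab x = 0 ∧ 2 ≤ lab y ∧ 2 ≤ lab z ∧ lab y ≠ lab z then (1 : ℤ) else 0) =
      (if dual lab (revPt x) = 1 ∧ 2 ≤ dual lab (revPt y) ∧ 2 ≤ dual lab (revPt z) ∧
        dual lab (revPt y) ≠ dual lab (revPt z) then 1 else 0) := by
    by_cases h2y : 2 ≤ lab y
    · by_cases h2z : 2 ≤ lab z
      · rw [hy.2 h2y, hz.2 h2z]; simp only [hx1]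
      · have : ¬ 2 ≤ dual lab (revPt z) := fun h => h2z (hz.1.mp h)
        simp [h2z, this]
    · have : ¬ 2 ≤ dual lab (revPt y) := fun h => h2y (hy.1.mp h)
      simp [h2y, this]
  have e3 : (if 2 ≤ lab x ∧ 2 ≤ lab y ∧ 2 ≤ lab z ∧ lab x ≠ lab y ∧ lab x ≠ lab z ∧ lab y ≠ lab z then (1 : ℤ) else 0) =
      (if 2 ≤ dual lab (revPt x) ∧ 2 ≤ dual lab (revPt y) ∧ 2 ≤ dual lab (revPt z) ∧
        dual lab (revPt x) ≠ dual lab (revPt y) ∧ dual lab (revPt x) ≠ dual lab (revPt z) ∧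
        dual lab (revPt y) ≠ dual lab (revPt z) then 1 else 0) := by
    by_cases h2x : 2 ≤ lab x
    · by_cases h2y : 2 ≤ lab y
      · by_cases h2z : 2 ≤ lab z
        · rw [hx.2 h2x, hy.2 h2y, hz.2 h2z]
        · have : ¬ 2 ≤ dual lab (revPt z) := fun h => h2z (hz.1.mp h)
          simp [h2z, this]
      · have : ¬ 2 ≤ dual lab (revPt y) := fun h => h2y (hy.1.mp h)
        simp [h2y, this]
    · have : ¬ 2 ≤ dual lab (revPt x) := fun h => h2x (hx.1.mp h)
      simp [h2x, this]
  have e4 : ((if lab z = 0 then (1 : ℤ) else 0) - (if lab z = 1 then 1 else 0)) =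
      ((if dual lab (revPt z) = 1 then 1 else 0) - (if dual lab (revPt z) = 0 then 1 else 0)) := by
    simp only [hz1, hz0]
  rw [e1, e2, e3, e4]

/-- **Pole B from pole T of the dual.**  The pole-`B` local condition for `lab` (with the median-rule multiplicities `mB`) follows from
the pole-`T` local condition for the dual labelling (with `mT`). [this work] -/
theorem localCond_B_of_dual {lab : Pt n → ℕ} (h : LocalCond 1 0 (dual lab) (mT (dual lab))) :
    LocalCond 0 1 lab (mB lab) := by
  intro t
  -- pass to the symmetric kernels
  have h6 := orbitSum_kerSym 0 1 lab (mB lab) t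
  have hT := orbitSum_kerSym 1 0 (dual lab) (mT (dual lab)) (revTr t)
  have hpos := h (revTr t)
  -- the symmetric B-kernel is the reversed symmetric T-kernel of the dual with the transfer slots transposed
  set κ₁ : (Fin 3 → Pt n) → ℤ := fun s =>
    6 * (if dual lab (s 0) = 1 ∧ dual lab (s 1) = 1 ∧ dual lab (s 2) = 0 then 1 else 0)
      - 3 * (if dual lab (s 0) = 1 ∧ 2 ≤ dual lab (s 1) ∧ 2 ≤ dual lab (s 2) ∧ dual lab (s 1) ≠ dual lab (s 2) then 1 else 0)
      - (if 2 ≤ dual lab (s 0) ∧ 2 ≤ dual lab (s 1) ∧ 2 ≤ dual lab (s 2) ∧ dual lab (s 0) ≠ dual lab (s 1) ∧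
            dual lab (s 0) ≠ dual lab (s 2) ∧ dual lab (s 1) ≠ dual lab (s 2) then 1 else 0) with hκ₁
  set κ₂ : (Fin 3 → Pt n) → ℤ := fun s =>
    6 * ((mT (dual lab) (s 0) (s 1) : ℤ) * ((if dual lab (s 2) = 1 then 1 else 0) - (if dual lab (s 2) = 0 then 1 else 0)))
    with hκ₂
  have hsymT : (fun s : Fin 3 → Pt n => kerSym 1 0 (dual lab) (mT (dual lab)) (s 0) (s 1) (s 2)) =
      fun s => κ₁ s - κ₂ s := by
    funext s; simp only [kerSym, hκ₁, hκ₂]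
  have hsymB : (fun s : Fin 3 → Pt n => kerSym 0 1 lab (mB lab) (s 0) (s 1) (s 2)) =
      fun s => κ₁ (revTr s) - κ₂ (slotPerm (Equiv.swap 0 1) (revTr s)) := by
    funext s
    rw [kerSym_B_eq]
    simp only [hκ₁, hκ₂, revTr, slotPerm, Equiv.swap_apply_left, Equiv.swap_apply_right,
      Equiv.swap_apply_of_ne_of_ne (show (2 : Fin 3) ≠ 0 by decide) (show (2 : Fin 3) ≠ 1 by decide)]
    ring
  have hB : orbitSum (fun s : Fin 3 → Pt n => kerSym 0 1 lab (mB lab) (s 0) (s 1) (s 2)) t =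
      orbitSum κ₁ (revTr t) - orbitSum κ₂ (revTr t) := by
    rw [hsymB, orbitSum_sub]
    have h1 : orbitSum (fun s => κ₁ (revTr s)) t = orbitSum κ₁ (revTr t) := orbitSum_revTr κ₁ t
    have h2 : orbitSum (fun s => κ₂ (slotPerm (Equiv.swap 0 1) (revTr s))) t = orbitSum κ₂ (revTr t) := by
      have := orbitSum_revTr (fun s => κ₂ (slotPerm (Equiv.swap 0 1) s)) t
      rw [this]
      exact orbitSum_slotPerm κ₂ (Equiv.swap 0 1) (revTr t)
    rw [h1, h2]
  have hT' : orbitSum (fun s : Fin 3 → Pt n => kerSym 1 0 (dual lab) (mT (dual lab)) (s 0) (s 1) (s 2)) (revTr t) =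
      orbitSum κ₁ (revTr t) - orbitSum κ₂ (revTr t) := by
    rw [hsymT, orbitSum_sub]
  have : 6 * orbitSum (fun s : Fin 3 → Pt n => ker 0 1 lab (mB lab) (s 0) (s 1) (s 2)) t =
      6 * orbitSum (fun s : Fin 3 → Pt n => ker 1 0 (dual lab) (mT (dual lab)) (s 0) (s 1) (s 2)) (revTr t) := by
    rw [← h6, ← hT, hB, hT']
  have h7 : orbitSum (fun s : Fin 3 → Pt n => ker 0 1 lab (mB lab) (s 0) (s 1) (s 2)) t =
      orbitSum (fun s : Fin 3 → Pt n => ker 1 0 (dual lab) (mT (dual lab)) (s 0) (s 1) (s 2)) (revTr t) := by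
    linarith
  rw [h7]; exact hpos

/-- **The three-block certificate reduces to its pole-`T` half**: if every monotone labelling of every product of three chains
satisfies the pole-`T` local condition with the median-rule transfer, then `ThreeBlockMedianCertificate` holds (pole `B` is
pole `T` of the dual labelling). [this work] -/
theorem threeBlockMedianCertificate_of_poleT
    (h : ∀ (n : Fin 3 → ℕ) (lab : Pt n → ℕ), IsMono lab → LocalCond 1 0 lab (mT lab)) :
    ThreeBlockMedianCertificate :=
  fun n lab hlab => ⟨h n lab hlab, localCond_B_of_dual (h n (dual lab) (dual_mono hlab))⟩

end DualityThree

end ChainCert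

end Summit.CriticalPhenomena.PercolationContinuityZ3.Theorems.SunflowerPartition
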